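import Summits.FinalStateConjecture.FinalStateConjecture.Theorems.ChannelsResolveTameDevelopmentsR.Negative.SlabMinkowskiCharts
import HarnessLib

/-!
# The slab development fails BOTH structural hypotheses of K2R ≡ Φ: it is not maximal and its future null
# infinity is incomplete — negative-side support for the crux `ChannelsResolveTameDevelopmentsR`
# (K2R, item `stmt-FinalStateConjecture-14075`)

Complement to `SlabMinkowskiLoadBearing` (`not_tameResolution_allDevelopments`: Φ with `IsMaximal` AND
complete `𝓘⁺` deleted is false, witnessed by the time slab `slab = {-1 < x⁰ < 1}` of Minkowski space). This
file certifies that the witness violates EACH of the two deleted hypotheses, so that it refutes neither single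
deletion (`Disproof.TameResolutionWithoutMaximal`, "Φ without completeness") — consistent with the disprover's
paper analysis that the pair is JOINTLY load-bearing:

* `slab_not_isMaximal` — Minkowski space does not embed into the slab as a development: an isometric immersion
  `ψ : ℝ⁴ → slab` would carry the `x⁰`-axis to a uniformly timelike curve of unbounded parameter length
  (`slab_chart_false` with the deviation identically zero);
* `not_hasCompleteNullInfinity_slab` — the outgoing null lines `t ↦ (t, y + t e)`, `t ∈ (-1, 1)`, are maximal
  normalised null rays of the slab from arbitrarily far slice points, with bounded affine domain and sojourn
  time `≤ 1` in any set (template: `WeakCosmicCensorshipMGHD/Negative/TruncatedMinkowski`, two-ended version).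

All results proved; no named facts.
-/

noncomputable section

open Bundle Set Function Filter TopologicalSpace Topology MeasureTheory
open scoped Manifold ContDiff Topology ENNReal

set_option linter.dupNamespace false

namespace Summit.FinalStateConjecture.FinalStateConjecture.Theorems.ChannelsResolveTameDevelopmentsR.Negative

open Literature.Geometry.Lorentzian Literature.Geometry.Lorentzian.Minkowski
open Summit.FinalStateConjecture.FinalStateConjecture.Theorems.WeakCosmicCensorshipMGHD.Negative
  (nullDir dirE3 norm_dirE3 nullDir_apply_zero nullDir_ne_zero bilin_nullDir bilin_basisVector_nullDir
    exists_not_mem_of_isCompact)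

/-! ### The slab is not a maximal development -/

/-- **The slab development is not maximal**: Minkowski space (a vacuum Cauchy development of the same datum)
does not embed into it. An embedding `ψ` is an isometric immersion, so along the `x⁰`-axis `s ↦ (s, 0)` the
image direction satisfies `η(dψ ∂₀, dψ ∂₀) = η(∂₀, ∂₀) = -1`, and `slab_chart_false` (applied to
`ψ ∘ Subtype.val` on the open set `⊤ ⊆ E4`) gives the contradiction. -/
theorem slab_not_isMaximal : ¬ slab.IsMaximal := by
  intro h
  obtain ⟨ψ, hψ, -, hiso, -, -⟩ := h vacuumCauchyDevelopment
  set σ : ℝ → (⊤ : Opens E4) := fun s ↦ ⟨s • E4.basisVector 0, trivial⟩ with hσ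
  refine slab_chart_false (O := ⊤) (ψ ∘ (Subtype.val : (⊤ : Opens E4) → E4))
    (hψ.comp contMDiff_subtype_val) σ 0 (E4.basisVector 0) 0 (fun s _ ↦ (zero_add _).symm)
    (Eventually.of_forall fun s ↦ ?_)
  have hval : MDifferentiableAt 𝓘(ℝ, E4) 𝓘(ℝ, E4) (Subtype.val : (⊤ : Opens E4) → E4) (σ s) :=
    (hasMFDerivAt_subtypeVal (I' := 𝓘(ℝ, E4)) (σ s)).mdifferentiableAt
  have hψd : MDifferentiableAt 𝓘(ℝ, E4) (𝓡 4) ψ (σ s : E4) := (hψ (σ s : E4)).mdifferentiableAt (by simp)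
  have hcomp : mfderiv 𝓘(ℝ, E4) (𝓡 4) (ψ ∘ (Subtype.val : (⊤ : Opens E4) → E4)) (σ s) (E4.basisVector 0) =
      mfderiv 𝓘(ℝ, E4) (𝓡 4) ψ (σ s : E4) (E4.basisVector 0) := by
    rw [mfderiv_comp (σ s) hψd hval]
    exact congrArg (mfderiv 𝓘(ℝ, E4) (𝓡 4) ψ (σ s : E4))
      (DFunLike.congr_fun (mfderiv_subtypeVal (I' := 𝓘(ℝ, E4)) (W := (⊤ : Opens E4)) (σ s))
        (E4.basisVector 0))
  have hiso' := DFunLike.congr_fun (DFunLike.congr_fun (hiso.2 (σ s : E4)) (E4.basisVector 0))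
    (E4.basisVector 0)
  change bilin (mfderiv 𝓘(ℝ, E4) (𝓡 4) ψ (σ s : E4) (E4.basisVector 0))
      (mfderiv 𝓘(ℝ, E4) (𝓡 4) ψ (σ s : E4) (E4.basisVector 0)) =
    bilin (E4.basisVector 0) (E4.basisVector 0) at hiso'
  rw [hcomp, hiso', bilin_basisVector_zero]
  norm_num

/-! ### The outgoing null rays `t ↦ (t, y + t e)` of the slab -/

/-- The cut-off affine parameter: `t` inside `(-1, 1)`, and `0` (a junk value inside the slab) outside. -/
def θ₂ (t : ℝ) : ℝ := if t ∈ Ioo (-1 : ℝ) 1 then t else 0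

/-- Inside `(-1, 1)` the cut-off parameter is the parameter. -/
theorem θ₂_of_mem {t : ℝ} (h : t ∈ Ioo (-1 : ℝ) 1) : θ₂ t = t := if_pos h

/-- The cut-off parameter always lies in `(-1, 1)`. -/
theorem θ₂_mem (t : ℝ) : θ₂ t ∈ Ioo (-1 : ℝ) 1 := by
  unfold θ₂; split_ifs with h
  · exact h
  · exact ⟨by norm_num, by norm_num⟩

/-- Coordinate expression of the ray from `y`: `(0, y) + θ₂(t) v`. -/
def rayCoord₂ (y : slice) (t : ℝ) : E4 := sliceEmbed y + θ₂ t • nullDir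

/-- The time coordinate along the ray is the cut-off parameter. -/
theorem rayCoord₂_apply_zero (y : slice) (t : ℝ) : rayCoord₂ y t 0 = θ₂ t := by
  simp [rayCoord₂, sliceEmbed_apply]

/-- The ray stays in the slab. -/
theorem rayCoord₂_mem (y : slice) (t : ℝ) : rayCoord₂ y t ∈ slabCut := by
  rw [mem_slabCut, rayCoord₂_apply_zero]
  exact θ₂_mem t

/-- The ray from `y` as a curve in the slab (all of `ℝ` is mapped into the slab; the geodesic parameter domain
is `(-1, 1)`). -/
def ray₂ (y : slice) (t : ℝ) : slabCut := ⟨rayCoord₂ y t, rayCoord₂_mem y t⟩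

/-- Near a parameter in `(-1, 1)` the ray is the affine null line `s ↦ (0, y) + s v`. -/
theorem rayCoord₂_eventuallyEq (y : slice) {t : ℝ} (ht : t ∈ Ioo (-1 : ℝ) 1) :
    rayCoord₂ y =ᶠ[𝓝 t] fun s ↦ sliceEmbed y + s • nullDir := by
  filter_upwards [Ioo_mem_nhds ht.1 ht.2] with s hs
  rw [rayCoord₂, θ₂_of_mem hs]

/-- Inside `(-1, 1)` the ray has derivative `v`. -/
theorem hasDerivAt_rayCoord₂ (y : slice) {t : ℝ} (ht : t ∈ Ioo (-1 : ℝ) 1) :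
    HasDerivAt (rayCoord₂ y) nullDir t := by
  have h : HasDerivAt (fun s : ℝ ↦ sliceEmbed y + s • nullDir) nullDir t := by
    simpa using ((hasDerivAt_id t).smul_const nullDir).const_add (sliceEmbed y)
  exact h.congr_of_eventuallyEq (rayCoord₂_eventuallyEq y ht)

/-- The ray starts at `ι y`. -/
theorem ray₂_zero (y : slice) :
    ray₂ y 0 = vacuumCauchyDevelopment.embedOpens slabCut sliceEmbed_mem_slabCut y := by
  apply Subtype.ext
  change rayCoord₂ y 0 = sliceEmbed y
  simp [rayCoord₂, θ₂_of_mem (show (0 : ℝ) ∈ Ioo (-1 : ℝ) 1 by norm_num)]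

/-- **The rays are null geodesics of the slab**, with velocity `v`, on the parameter set `(-1, 1)`. -/
theorem isGeodesicOn_ray₂ [slabMetric.toPseudoRiemannianMetric.HasLeviCivita] (y : slice) :
    IsGeodesicOn slabMetric.toPseudoRiemannianMetric.leviCivita (ray₂ y) (Ioo (-1) 1) ∧
      ∀ t ∈ Ioo (-1 : ℝ) 1, velocity 𝓘(ℝ, E4) (ray₂ y) t = nullDir :=
  OpensChart.isGeodesicOn_of_hasDerivAt (g := slabMetric.toPseudoRiemannianMetric)
    (G := fun _ : E4 ↦ bilin) (fun _ ↦ rfl) (fun _ ↦ differentiableAt_const _) isOpen_Ioo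
    (c := rayCoord₂ y) (c' := fun _ ↦ nullDir) (c'' := fun _ ↦ 0) (fun _ ↦ rfl)
    (fun t ht ↦ hasDerivAt_rayCoord₂ y ht) (fun t _ ↦ hasDerivAt_const t nullDir)
    (fun t _ ↦ by rw [christoffel_slab_eq_zero, add_zero])

/-- A geodesic extension of the ray to an open interval containing a boundary parameter `b = ±1` is
continuous there with a value IN the slab, whereas the ray tends to the point `(0, y) + b v` of time `b`,
outside the slab: contradiction. (The common step of the two ends of `isMaximalGeodesicOn_ray₂`.) -/
theorem ray₂_noExtension [slabMetric.toPseudoRiemannianMetric.HasLeviCivita] (y : slice) {γ' : ℝ → slabCut}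
    {s' : Set ℝ} (hγ' : IsGeodesicOn slabMetric.toPseudoRiemannianMetric.leviCivita γ' s')
    (heq : EqOn (ray₂ y) γ' (Ioo (-1) 1)) {b : ℝ} (hb : b ∈ s') (hb1 : b = 1 ∨ b = -1)
    {l : Filter ℝ} [l.NeBot] (hl : l ≤ 𝓝 b) (hlI : ∀ᶠ t in l, t ∈ Ioo (-1 : ℝ) 1) : False := by
  -- `γ'` is continuous at `b`
  have hcont : ContinuousAt (fun t ↦ ((γ' t : slabCut) : E4)) b := by
    have hL := (hγ'.1 b hb).continuousAt
    have hp : Continuous (TotalSpace.proj : TangentBundle 𝓘(ℝ, E4) slabCut → slabCut) :=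
      FiberBundle.continuous_proj E4 (TangentSpace 𝓘(ℝ, E4))
    exact continuous_subtype_val.continuousAt.comp ((hp.continuousAt).comp hL)
  have hlim1 : Tendsto (fun t ↦ ((γ' t : slabCut) : E4)) l (𝓝 ((γ' b : slabCut) : E4)) :=
    hcont.tendsto.mono_left hl
  have hlim2 : Tendsto (fun t ↦ ((γ' t : slabCut) : E4)) l (𝓝 (sliceEmbed y + b • nullDir)) := by
    have hline : Tendsto (fun s : ℝ ↦ sliceEmbed y + s • nullDir) l (𝓝 (sliceEmbed y + b • nullDir)) :=
      ((continuous_const.add (continuous_id.smul continuous_const)).tendsto b).mono_left hl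
    refine hline.congr' ?_
    filter_upwards [hlI] with t ht
    have := heq ht
    rw [← this]
    change sliceEmbed y + t • nullDir = rayCoord₂ y t
    rw [rayCoord₂, θ₂_of_mem ht]
  have hval : ((γ' b : slabCut) : E4) = sliceEmbed y + b • nullDir := tendsto_nhds_unique hlim1 hlim2
  have hmem := mem_slabCut.1 (γ' b).2
  rw [hval] at hmem
  simp [sliceEmbed_apply] at hmem
  rcases hb1 with rfl | rfl <;> norm_num at hmem

/-- **The rays are MAXIMAL geodesics of the slab on `(-1, 1)`**: a geodesic extension to an open interval
`s' ⊋ (-1, 1)` contains `1` or `-1` (`ray₂_noExtension`). -/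
theorem isMaximalGeodesicOn_ray₂ [slabMetric.toPseudoRiemannianMetric.HasLeviCivita] (y : slice) :
    IsMaximalGeodesicOn slabMetric.toPseudoRiemannianMetric.leviCivita (ray₂ y) (Ioo (-1) 1) := by
  refine ⟨isOpen_Ioo, ordConnected_Ioo, (isGeodesicOn_ray₂ y).1, fun γ' s' _ hsc' hsub hγ' heq ↦ ?_⟩
  by_contra hne
  obtain ⟨t', ht', ht'n⟩ : ∃ t' ∈ s', t' ∉ Ioo (-1 : ℝ) 1 := by
    by_contra hcon
    push Not at hcon
    exact hne (Subset.antisymm hcon hsub)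
  have h0 : (0 : ℝ) ∈ s' := hsub (show (0 : ℝ) ∈ Ioo (-1 : ℝ) 1 by norm_num)
  rcases le_or_gt 1 t' with h1 | h1
  · -- the upper end: `1 ∈ s'`, limit from the left
    have hb : (1 : ℝ) ∈ s' := hsc'.out h0 ht' ⟨zero_le_one, h1⟩
    refine ray₂_noExtension y hγ' heq hb (Or.inl rfl) (l := 𝓝[<] (1 : ℝ)) nhdsWithin_le_nhds ?_
    filter_upwards [Ioo_mem_nhdsLT (show (-1 : ℝ) < 1 by norm_num)] with t ht using ht
  · -- the lower end: `-1 ∈ s'`, limit from the right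
    have ht'le : t' ≤ -1 := by
      by_contra hcon
      exact ht'n ⟨lt_of_not_ge hcon, h1⟩
    have hb : (-1 : ℝ) ∈ s' := hsc'.out ht' h0 ⟨ht'le, by norm_num⟩
    refine ray₂_noExtension y hγ' heq hb (Or.inr rfl) (l := 𝓝[>] (-1 : ℝ)) nhdsWithin_le_nhds ?_
    filter_upwards [Ioo_mem_nhdsGT (show (-1 : ℝ) < 1 by norm_num)] with t ht using ht

/-- **The rays are normalised future null rays of the slab development** from the points of the slice:
maximal null geodesics with `γ 0 = ι y`, future-directed velocity `v`, `η(v, ∂ₜ) = -1`. -/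
theorem isNormalisedNullRayFrom_ray₂ [slab.metric.HasLeviCivita] (y : slice) :
    slab.metric.IsNormalisedNullRayFrom slab.timeOrientation slab.embed slab.normal y (ray₂ y)
      (Ioo (-1) 1) := by
  haveI : slabMetric.toPseudoRiemannianMetric.HasLeviCivita := ‹slab.metric.HasLeviCivita›
  have hv : velocity 𝓘(ℝ, E4) (ray₂ y) 0 = nullDir := (isGeodesicOn_ray₂ y).2 0 (by norm_num)
  refine ⟨isMaximalGeodesicOn_ray₂ y, by norm_num, ray₂_zero y, ?_, ?_, ?_⟩
  · change bilin (velocity 𝓘(ℝ, E4) (ray₂ y) 0) (velocity 𝓘(ℝ, E4) (ray₂ y) 0) = 0 ∧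
      velocity 𝓘(ℝ, E4) (ray₂ y) 0 ≠ 0
    rw [hv]
    exact ⟨bilin_nullDir, nullDir_ne_zero⟩
  · change (bilin (velocity 𝓘(ℝ, E4) (ray₂ y) 0) (velocity 𝓘(ℝ, E4) (ray₂ y) 0) ≤ 0 ∧
        velocity 𝓘(ℝ, E4) (ray₂ y) 0 ≠ 0) ∧
      bilin (E4.basisVector 0) (velocity 𝓘(ℝ, E4) (ray₂ y) 0) < 0
    rw [hv, bilin_nullDir, bilin_basisVector_nullDir]
    exact ⟨⟨le_rfl, nullDir_ne_zero⟩, by norm_num⟩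
  · change bilin (velocity 𝓘(ℝ, E4) (ray₂ y) 0) (E4.basisVector 0) = -1
    rw [hv, bilin_symm, bilin_basisVector_nullDir]

/-! ### Incompleteness of future null infinity of the slab development -/

/-- **The slab development has INCOMPLETE future null infinity** (sojourn form): for any candidate `B₀` and
the threshold `s = 2`, whatever compact `B₁` is exempted there is a slice point `y ∉ B₁`, and the normalised
null ray `ray₂ y` has affine domain `(-1, 1)` — bounded above — and sojourn time `≤ |[0, 1)| = 1 < 2` in any
set. So the slab fails the completeness hypothesis of K2R/Φ (as well as maximality, `slab_not_isMaximal`). -/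
theorem not_hasCompleteNullInfinity_slab :
    ¬ _root_.Summit.FinalStateConjecture.HasCompleteNullInfinity slab.toCauchyDevelopment := by
  intro h
  haveI hLC : slab.metric.HasLeviCivita := slab.metric.toPseudoRiemannianMetric.hasLeviCivita
  have h' : slab.metric.HasCompleteFutureNullInfinity slab.timeOrientation slab.embed slab.normal := h
  obtain ⟨B₀, -, hB⟩ := h'
  obtain ⟨B₁, hB₁, hrays⟩ := hB 2 two_pos
  obtain ⟨y, hy⟩ := exists_not_mem_of_isCompact hB₁
  rcases hrays y hy (ray₂ y) (Ioo (-1) 1) (isNormalisedNullRayFrom_ray₂ y) with hunb | hsoj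
  · exact hunb bddAbove_Ioo
  · have hle := hsoj.trans (sojournTime_le_volume (ray₂ y) (Ioo (-1) 1) _)
    have hsub : Ioo (-1 : ℝ) 1 ∩ Ici 0 ⊆ Icc 0 1 := fun t ht ↦ ⟨ht.2, ht.1.2.le⟩
    have hle' := hle.trans (measure_mono hsub)
    rw [Real.volume_Icc, sub_zero, ENNReal.ofReal_le_ofReal_iff zero_le_one] at hle'
    norm_num at hle'

/-- **Summary: the slab fails exactly the two structural hypotheses of K2R/Φ** — it is neither maximal nor
complete — while satisfying (i), (ii) and violating the conclusion (`slab_witness`). -/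
theorem slab_fails_both_deleted_hypotheses :
    ¬ slab.IsMaximal ∧ ¬ _root_.Summit.FinalStateConjecture.HasCompleteNullInfinity slab.toCauchyDevelopment :=
  ⟨slab_not_isMaximal, not_hasCompleteNullInfinity_slab⟩

end Summit.FinalStateConjecture.FinalStateConjecture.Theorems.ChannelsResolveTameDevelopmentsR.Negative

end
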